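import Mathlib
import Summits.Parity.GeneralizedHardyLittlewood.Theses.LiouvilleShiftedTables
import Summits.Parity.GeneralizedHardyLittlewood.Theorems.TableChowla.Negative.TableChowlaExceptionalSet
import Summits.Parity.GeneralizedHardyLittlewood.Theorems.LiouvilleShiftedTablesTableChowlaPeriodicOfBVAux
import Summits.Parity.GeneralizedHardyLittlewood.Theorems.LiouvilleShiftedTablesTableChowlaBVLiouville

/-!
# `stub_archTwist_periodicCols` — the residual of line `helson-kronecker-inverse` on archimedean
# twists of periodic column weights (r4 calibration T3)

Crux `LiouvilleShiftedTables.TableChowla` (stmt-Parity-14270), line `helson-kronecker-inverse`, lead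
reshape r4. The residual `MeanSquareCM` asks `∑_{a ∈ (⌊A⌋,⌊2A⌋]} ‖∑_{b ≤ ⌊y⌋} g(b) λ(ab+c)‖² ≤
x·(x/A)/(log x)^C`, `y ≤ x/A`, for completely multiplicative 1-bounded column weights `g` (open).
This file proves it for the weights that agree on `[1, ⌊x/A⌋]` with `h·w`, `h` `q`-periodic and
1-bounded (`1 ≤ q ≤ (log x)^K`), `w` 1-bounded of total variation `≤ (log x)^K` on the columns
(e.g. `w(b) = b^{it}`): every major-arc pretentious direction `χ(n) n^{it}` is a theorem. No
multiplicativity of `g` is used.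
* `meanSquare_periodicCols_nat` — the column-periodic bound for an ARBITRARY `q`-periodic 1-bounded
  weight `h` at every integer height `Y ≤ ⌊x/A⌋`, from Bombieri–Vinogradov for `λ` (`BVLiouville`,
  the landed `stub_bv`); the body is the landed proof of `stub_periodicCols_of_bv`
  (`Theorems/LiouvilleShiftedTablesTableChowlaPeriodicColsOfBV.lean`), which never used complete
  multiplicativity, with the `g/h` bookkeeping removed (`meanSquare_periodicCols_bounded`: real
  height `y ≤ x/A`);
* `stub_archTwist_periodicCols` — Abel summation in `b` against `w`, the weighted Cauchy–Schwarz
  inequality `(∑ d_b ‖S_b‖)² ≤ (∑ d_b)(∑ d_b ‖S_b‖²)` with `d_b = ‖w(b+1) − w(b)‖`, and the periodic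
  bound at exponent `C + 2K + 2` uniformly in the height `u ≤ ⌊y⌋`.
-/

namespace Summit.Parity.GeneralizedHardyLittlewood.Theorems.TableChowla.HelsonKroneckerInverse

open Finset ArithmeticFunction
open Summit.Parity.GeneralizedHardyLittlewood.Theses.LiouvilleShiftedTables
open PeriodicOfBV

noncomputable section

/-- **Column-periodic mean square, CM-free.** Bombieri–Vinogradov for `λ` implies: for every
`q`-periodic 1-bounded weight `h`, `1 ≤ q ≤ (log x)^K`, and every integer height `Y ≤ ⌊x/A⌋`,
`∑_{a ∈ (⌊A⌋,⌊2A⌋]} ‖∑_{1 ≤ b ≤ Y} h(b) λ(ab+c)‖² ≤ x·(x/A)/(log x)^C` for `x ≥ x₀(c,δ,C,K)`,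
uniformly in `x^δ ≤ A ≤ x^{1/3+δ}` (`δ ≤ 1/12`). -/
theorem meanSquare_periodicCols_nat (hBV : BVLiouville) (c : ℤ) {δ : ℝ} (hδ : 0 < δ)
    (hδ12 : δ ≤ 1 / 12) {C K : ℝ} (hC : 0 < C) (hK : 0 < K) :
    ∃ x₀ : ℝ, ∀ x : ℝ, x₀ ≤ x → ∀ A : ℝ, x ^ δ ≤ A → A ≤ x ^ (1 / 3 + δ) →
    ∀ h : ℕ → ℂ, ∀ q : ℕ, 1 ≤ q → (q : ℝ) ≤ Real.log x ^ K → Function.Periodic h q →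
    (∀ n : ℕ, ‖h n‖ ≤ 1) → ∀ Y : ℕ, Y ≤ ⌊x / A⌋₊ →
      ∑ a ∈ Finset.Ioc ⌊A⌋₊ ⌊2 * A⌋₊,
          ‖∑ b ∈ Finset.Icc 1 Y, h b *
            ((ArithmeticFunction.liouville (Int.toNat ((a : ℤ) * b + c)) : ℝ) : ℂ)‖ ^ 2 ≤
        x * (x / A) / Real.log x ^ C := by
  -- adapted from Theorems/LiouvilleShiftedTablesTableChowlaPeriodicColsOfBV.lean (p83535)
  -- ONE instance of Bombieri–Vinogradov: `ε = 1/24`, exponent `C + K + 1`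
  obtain ⟨Cbv, xbv, hbv⟩ := hBV (1 / 24) (by norm_num) (C + K + 1) (by linarith)
  set Cb : ℝ := max Cbv 1 with hCb_def
  have hCb1 : 1 ≤ Cb := le_max_right _ _
  have hCbv : Cbv ≤ Cb := le_max_left _ _
  -- eventualities in `x`
  obtain ⟨X₁, hX₁⟩ := Negative.eventually_log_rpow_le (show (0 : ℝ) < 1 / 24 by norm_num) K
  obtain ⟨X₂, hX₂⟩ := Negative.eventually_log_rpow_le (show (0 : ℝ) < 7 / 12 by norm_num) (K + C)
  obtain ⟨X₃, hX₃⟩ := Negative.eventually_log_rpow_le hδ 1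
  obtain ⟨X₄, hX₄⟩ := Negative.eventually_rpow_log_ge one_pos (max (4 * Cb) (|c| : ℝ))
  refine ⟨max (max (max X₁ X₂) (max X₃ X₄)) (max xbv 1), ?_⟩
  intro x hx A hA hA' h q hq hqK hper hh1 Y hYcols
  simp only [max_le_iff] at hx
  obtain ⟨⟨⟨hx1', hx2'⟩, ⟨hx3', hx4'⟩⟩, ⟨hxbv, hx1⟩⟩ := hx
  obtain ⟨hlogK, hL2⟩ := hX₁ x hx1'
  obtain ⟨hlogKC, -⟩ := hX₂ x hx2'
  obtain ⟨hlog1, -⟩ := hX₃ x hx3'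
  obtain ⟨hlogc, -⟩ := hX₄ x hx4'
  rw [Real.rpow_one] at hlog1 hlogc
  set L := Real.log x with hL_def
  have hxpos : 0 < x := by linarith
  have hL0 : 0 < L := by linarith
  have hA1 : 1 ≤ A := (Real.one_le_rpow hx1 hδ.le).trans hA
  have hApos : 0 < A := by linarith
  have hcL : (|c| : ℝ) ≤ L := (le_max_right _ _).trans hlogc
  have hCbL : 4 * Cb ≤ L := (le_max_left _ _).trans hlogc
  have hcA : (|c| : ℝ) + 1 ≤ A := by linarith
  -- window sizes: `A ≤ x^{5/12}`, `x/A ≥ x^{7/12} ≥ 4 L^{K+C}`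
  have hx512 : x ^ (1 / 3 + δ) ≤ x ^ ((5 : ℝ) / 12) :=
    Real.rpow_le_rpow_of_exponent_le hx1 (by linarith)
  have hA512 : A ≤ x ^ ((5 : ℝ) / 12) := hA'.trans hx512
  have hxA : x ^ ((7 : ℝ) / 12) ≤ x / A := by
    calc x ^ ((7 : ℝ) / 12) = x ^ ((1 : ℝ) - 5 / 12) := by norm_num
      _ = x / x ^ ((5 : ℝ) / 12) := by rw [Real.rpow_sub hxpos, Real.rpow_one]
      _ ≤ x / A := div_le_div_of_nonneg_left hxpos.le hApos hA512
  have hwin : 4 * L ^ (K + C) ≤ x / A := hlogKC.trans hxA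
  -- the columns `Y ≤ ⌊x/A⌋ ≤ x/A`
  have hYle : (Y : ℝ) ≤ x / A :=
    le_trans (by exact_mod_cast hYcols) (Nat.floor_le (by positivity))
  -- the rows `a ∈ (⌊A⌋, ⌊2A⌋]`: `A < a ≤ 2A`, `|c| < a`, `#rows ≤ 2A`
  set rows := Ioc ⌊A⌋₊ ⌊2 * A⌋₊ with hrows_def
  have hrowA : ∀ a ∈ rows, A < (a : ℝ) ∧ (a : ℝ) ≤ 2 * A := by
    intro a ha
    rw [hrows_def, mem_Ioc] at ha
    constructor
    · have h1 : A < (⌊A⌋₊ : ℝ) + 1 := Nat.lt_floor_add_one A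
      have h2 : ((⌊A⌋₊ + 1 : ℕ) : ℝ) ≤ a := by exact_mod_cast ha.1
      push_cast at h2; linarith
    · exact le_trans (by exact_mod_cast ha.2) (Nat.floor_le (by linarith))
  have hrows_pos : ∀ a ∈ rows, 0 < a := by
    intro a ha
    have h0 : (0 : ℝ) < a := by linarith [(hrowA a ha).1]
    exact_mod_cast h0
  have hca : ∀ a ∈ rows, |c| < (a : ℤ) := by
    intro a ha
    have h : ((|c| : ℤ) : ℝ) < ((a : ℤ) : ℝ) := by push_cast; linarith [(hrowA a ha).1]
    exact_mod_cast h
  have hR : ((rows.card : ℕ) : ℝ) ≤ 2 * A := by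
    rw [hrows_def, Nat.card_Ioc, Nat.cast_sub (Nat.floor_le_floor (by linarith : A ≤ 2 * A))]
    have h1 : (⌊2 * A⌋₊ : ℝ) ≤ 2 * A := Nat.floor_le (by linarith)
    have h2 : A - 1 < (⌊A⌋₊ : ℝ) := by have := Nat.lt_floor_add_one A; linarith
    linarith
  -- the BV scale `X = 2x` and the moduli `aq ≤ ⌊X^{1/2 - 1/24}⌋`
  set X : ℝ := 2 * x with hX_def
  have hX0 : 0 ≤ X := by positivity
  have hD : ∀ a ∈ rows, a * q ≤ ⌊X ^ ((1 : ℝ) / 2 - 1 / 24)⌋₊ := by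
    intro a ha
    apply Nat.le_floor
    have ha2 : (a : ℝ) ≤ 2 * x ^ ((5 : ℝ) / 12) := by linarith [(hrowA a ha).2]
    have hq' : (q : ℝ) ≤ x ^ ((1 : ℝ) / 24) / 4 := by
      rw [le_div_iff₀ (by norm_num : (0 : ℝ) < 4)]; linarith
    calc ((a * q : ℕ) : ℝ) = (a : ℝ) * q := by push_cast; ring
      _ ≤ (2 * x ^ ((5 : ℝ) / 12)) * (x ^ ((1 : ℝ) / 24) / 4) :=
          mul_le_mul ha2 hq' (by positivity) (by positivity)
      _ = x ^ ((5 : ℝ) / 12) * x ^ ((1 : ℝ) / 24) / 2 := by ring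
      _ ≤ x ^ ((5 : ℝ) / 12) * x ^ ((1 : ℝ) / 24) := half_le_self (by positivity)
      _ = x ^ ((1 : ℝ) / 2 - 1 / 24) := by rw [← Real.rpow_add hxpos]; norm_num
      _ ≤ X ^ ((1 : ℝ) / 2 - 1 / 24) := Real.rpow_le_rpow hxpos.le (by linarith) (by norm_num)
  -- BV at scale `X`, and the size of its bound
  have hBVX := hbv X (by linarith)
  have hBle : Cbv * X / Real.log X ^ (C + K + 1) ≤ Cb * (2 * x) / L ^ (C + K + 1) := by
    have hlogX : L ≤ Real.log X := Real.log_le_log hxpos (by linarith)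
    have hpow : L ^ (C + K + 1) ≤ Real.log X ^ (C + K + 1) :=
      Real.rpow_le_rpow hL0.le hlogX (by linarith)
    have hLp : 0 < L ^ (C + K + 1) := Real.rpow_pos_of_pos hL0 _
    calc Cbv * X / Real.log X ^ (C + K + 1) ≤ Cb * X / Real.log X ^ (C + K + 1) :=
          div_le_div_of_nonneg_right (mul_le_mul_of_nonneg_right hCbv hX0) (hLp.le.trans hpow)
      _ ≤ Cb * X / L ^ (C + K + 1) := div_le_div_of_nonneg_left (by positivity) hLp hpow
  -- Step 1: each row, `‖T_a‖² ≤ Y · ∑_r |S(a,r)|`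
  have hstep1 : ∀ a ∈ rows,
      ‖∑ b ∈ Icc 1 Y, h b * ((liouville (Int.toNat ((a : ℤ) * b + c)) : ℝ) : ℂ)‖ ^ 2 ≤
        (Y : ℝ) * ∑ r ∈ range q, |∑ b ∈ (Icc 1 Y).filter (fun b => b % q = r),
          (liouville (Int.toNat ((a : ℤ) * b + c)) : ℝ)| := by
    intro a _
    rw [sq]
    exact mul_le_mul (norm_sum_le_card hh1 c Y a)
      (norm_sum_periodic_le hq hper hh1 (Icc 1 Y)
        (fun b => (liouville (Int.toNat ((a : ℤ) * b + c)) : ℝ)))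
      (norm_nonneg _) (Nat.cast_nonneg Y)
  -- Step 2: each residue class `r` is ONE instance of BV over the rows
  have hstep2 : ∀ r ∈ range q,
      ∑ a ∈ rows, |∑ b ∈ (Icc 1 Y).filter (fun b => b % q = r),
          (liouville (Int.toNat ((a : ℤ) * b + c)) : ℝ)| ≤
        Cbv * X / Real.log X ^ (C + K + 1) + rows.card := by
    intro r hr
    rw [mem_range] at hr
    choose! ρ m hρ0 hρlt hmY hSle using
      fun a (ha : a ∈ rows) => periodic_classSum_le c q Y a r hq hr (hca a ha)
    have hm : ∀ a ∈ rows, ((a * q : ℕ) : ℝ) * m a ≤ X := by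
      intro a ha
      have h1 : ((q * m a : ℕ) : ℝ) ≤ Y := by exact_mod_cast hmY a ha
      calc ((a * q : ℕ) : ℝ) * m a = (a : ℝ) * ((q * m a : ℕ) : ℝ) := by push_cast; ring
        _ ≤ (2 * A) * (x / A) :=
            mul_le_mul (hrowA a ha).2 (h1.trans hYle) (by positivity) (by positivity)
        _ = X := by rw [hX_def]; field_simp
    calc ∑ a ∈ rows, |∑ b ∈ (Icc 1 Y).filter (fun b => b % q = r),
            (liouville (Int.toNat ((a : ℤ) * b + c)) : ℝ)|
        ≤ ∑ a ∈ rows,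
            (|∑ n ∈ Icc 1 (m a), (liouville (Int.toNat (((a * q : ℕ) : ℤ) * n + ρ a)) : ℝ)| + 1) :=
          sum_le_sum fun a ha => hSle a ha
      _ = ∑ a ∈ rows,
            |∑ n ∈ Icc 1 (m a), (liouville (Int.toNat (((a * q : ℕ) : ℤ) * n + ρ a)) : ℝ)| +
            rows.card := by
          rw [sum_add_distrib, sum_const, nsmul_eq_mul, mul_one]
      _ ≤ Cbv * X / Real.log X ^ (C + K + 1) + rows.card :=
          add_le_add (sum_rows_bvInner_le hq hrows_pos hD hX0 ρ m
            (fun a ha => ⟨hρ0 a ha, hρlt a ha⟩) hm hBVX) le_rfl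
  -- Step 3: assemble
  have hq0 : (0 : ℝ) ≤ q := Nat.cast_nonneg q
  calc ∑ a ∈ rows, ‖∑ b ∈ Icc 1 Y, h b * ((liouville (Int.toNat ((a : ℤ) * b + c)) : ℝ) : ℂ)‖ ^ 2
      ≤ ∑ a ∈ rows, ((Y : ℝ) * ∑ r ∈ range q, |∑ b ∈ (Icc 1 Y).filter (fun b => b % q = r),
          (liouville (Int.toNat ((a : ℤ) * b + c)) : ℝ)|) :=
        sum_le_sum hstep1
    _ = (Y : ℝ) * ∑ r ∈ range q, ∑ a ∈ rows, |∑ b ∈ (Icc 1 Y).filter (fun b => b % q = r),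
          (liouville (Int.toNat ((a : ℤ) * b + c)) : ℝ)| := by
        rw [← mul_sum, sum_comm]
    _ ≤ (Y : ℝ) * ∑ _r ∈ range q, (Cbv * X / Real.log X ^ (C + K + 1) + rows.card) :=
        mul_le_mul_of_nonneg_left (sum_le_sum hstep2) (Nat.cast_nonneg Y)
    _ = (Y : ℝ) * (q * (Cbv * X / Real.log X ^ (C + K + 1) + rows.card)) := by
        rw [sum_const, card_range, nsmul_eq_mul]
    _ ≤ (Y : ℝ) * (q * (Cb * (2 * x) / L ^ (C + K + 1) + rows.card)) :=
        mul_le_mul_of_nonneg_left (mul_le_mul_of_nonneg_left (add_le_add hBle le_rfl) hq0)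
          (Nat.cast_nonneg Y)
    _ ≤ x * (x / A) / L ^ C :=
        final_bound hxpos hApos hL0 hYle hq0 hqK (by linarith) hCbL (Nat.cast_nonneg _) hR hwin

/-- The same bound at a real height `y ≤ x/A` (the column range `[1, ⌊y⌋]`), i.e. the statement
`MeanSquareCMPeriodicCols` of the skeleton WITHOUT the complete-multiplicativity hypothesis and for
the periodic weight itself. -/
theorem meanSquare_periodicCols_bounded (hBV : BVLiouville) :
    ∀ c : ℤ, c ≠ 0 → ∀ δ : ℝ, 0 < δ → δ ≤ 1 / 12 → ∀ C : ℝ, 0 < C → ∀ K : ℝ, 0 < K → ∃ x₀ : ℝ,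
    ∀ x : ℝ, x₀ ≤ x → ∀ A : ℝ, x ^ δ ≤ A → A ≤ x ^ (1 / 3 + δ) →
    ∀ h : ℕ → ℂ, ∀ q : ℕ, 1 ≤ q → (q : ℝ) ≤ Real.log x ^ K → Function.Periodic h q →
    (∀ n : ℕ, ‖h n‖ ≤ 1) → ∀ y : ℝ, y ≤ x / A →
      ∑ a ∈ Finset.Ioc ⌊A⌋₊ ⌊2 * A⌋₊,
          ‖∑ b ∈ Finset.Icc 1 ⌊y⌋₊, h b *
            ((ArithmeticFunction.liouville (Int.toNat ((a : ℤ) * b + c)) : ℝ) : ℂ)‖ ^ 2 ≤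
        x * (x / A) / Real.log x ^ C := by
  intro c _ δ hδ hδ12 C hC K hK
  obtain ⟨x₀, hx₀⟩ := meanSquare_periodicCols_nat hBV c hδ hδ12 hC hK
  refine ⟨x₀, fun x hx A hA hA' h q hq hqK hper hh1 y hy =>
    hx₀ x hx A hA hA' h q hq hqK hper hh1 _ ?_⟩
  rcases le_or_gt 0 y with hy0 | hy0
  · exact Nat.floor_mono hy
  · rw [Nat.floor_of_nonpos hy0.le]; exact Nat.zero_le _

/-- `∑_{1 ≤ b ≤ Y} f(b) = ∑_{i < Y} f(i+1)`. -/
private theorem sum_Icc_one_eq_sum_range {E : Type*} [AddCommMonoid E] (f : ℕ → E) :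
    ∀ Y : ℕ, ∑ b ∈ Icc 1 Y, f b = ∑ i ∈ range Y, f (i + 1)
  | 0 => by simp
  | Y + 1 => by
    rw [sum_Icc_succ_top (Nat.le_add_left 1 Y), sum_Icc_one_eq_sum_range f Y, sum_range_succ]

/-- Abel summation: `∑_{i<Y} w(i+1) (F(i+1) − F(i)) = w(Y) F(Y) − ∑_{1≤b<Y} (w(b+1) − w(b)) F(b)`
(`F(0) = 0`). -/
private theorem abel_range {R : Type*} [CommRing R] (w F : ℕ → R) (hF : F 0 = 0) :
    ∀ Y : ℕ, ∑ i ∈ range Y, w (i + 1) * (F (i + 1) - F i) =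
      w Y * F Y - ∑ b ∈ Ico 1 Y, (w (b + 1) - w b) * F b
  | 0 => by simp [hF]
  | Y + 1 => by
    rw [sum_range_succ, abel_range w F hF Y]
    rcases Nat.eq_zero_or_pos Y with rfl | hY
    · simp [hF]
    · rw [sum_Ico_succ_top hY]; ring

/-- ONE ROW: Abel summation against the 1-bounded weight `w`, then the weighted Cauchy–Schwarz
inequality with the weights `‖w(b+1) − w(b)‖` (of total mass `≤ V`), `S_u = ∑_{j ≤ u} F_j`:
`‖∑_{b ≤ Y} w_b F_b‖² ≤ 2 ‖S_Y‖² + 2 V ∑_{1 ≤ b < Y} ‖w_{b+1} − w_b‖ ‖S_b‖²`. -/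
private theorem row_sq_le (F w S : ℕ → ℂ) (hS : ∀ u, S u = ∑ j ∈ Icc 1 u, F j)
    (hw1 : ∀ n, ‖w n‖ ≤ 1) (Y : ℕ) {V : ℝ} (hV : ∑ b ∈ Ico 1 Y, ‖w (b + 1) - w b‖ ≤ V) :
    ‖∑ b ∈ Icc 1 Y, w b * F b‖ ^ 2 ≤
      2 * ‖S Y‖ ^ 2 + 2 * V * ∑ b ∈ Ico 1 Y, ‖w (b + 1) - w b‖ * ‖S b‖ ^ 2 := by
  have hS0 : S 0 = 0 := by simp [hS]
  have hstep : ∀ i, S (i + 1) - S i = F (i + 1) := fun i => by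
    rw [hS, hS, sum_Icc_succ_top (Nat.le_add_left 1 i)]; ring
  have habel : ∑ b ∈ Icc 1 Y, w b * F b =
      w Y * S Y - ∑ b ∈ Ico 1 Y, (w (b + 1) - w b) * S b := by
    rw [← abel_range w S hS0 Y]
    calc ∑ b ∈ Icc 1 Y, w b * F b = ∑ i ∈ range Y, w (i + 1) * F (i + 1) :=
          sum_Icc_one_eq_sum_range _ Y
      _ = ∑ i ∈ range Y, w (i + 1) * (S (i + 1) - S i) :=
          sum_congr rfl fun i _ => by rw [hstep i]
  have hd0 : ∀ b, 0 ≤ ‖w (b + 1) - w b‖ := fun b => norm_nonneg _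
  set T := ∑ b ∈ Ico 1 Y, ‖w (b + 1) - w b‖ * ‖S b‖ with hT_def
  have hT0 : 0 ≤ T := sum_nonneg fun b _ => by positivity
  have hnorm : ‖∑ b ∈ Icc 1 Y, w b * F b‖ ≤ ‖S Y‖ + T := by
    rw [habel]
    refine (norm_sub_le _ _).trans (add_le_add ?_ ?_)
    · rw [norm_mul]; exact mul_le_of_le_one_left (norm_nonneg _) (hw1 Y)
    · exact (norm_sum_le _ _).trans_eq (sum_congr rfl fun b _ => norm_mul _ _)
  have hW0 : 0 ≤ ∑ b ∈ Ico 1 Y, ‖w (b + 1) - w b‖ * ‖S b‖ ^ 2 :=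
    sum_nonneg fun b _ => by positivity
  have hCS : T ^ 2 ≤ (∑ b ∈ Ico 1 Y, ‖w (b + 1) - w b‖) *
      ∑ b ∈ Ico 1 Y, ‖w (b + 1) - w b‖ * ‖S b‖ ^ 2 :=
    sum_sq_le_sum_mul_sum_of_sq_le_mul _ (fun b _ => hd0 b) (fun b _ => by positivity)
      (fun b _ => le_of_eq (by ring))
  calc ‖∑ b ∈ Icc 1 Y, w b * F b‖ ^ 2 ≤ (‖S Y‖ + T) ^ 2 :=
        pow_le_pow_left₀ (norm_nonneg _) hnorm 2
    _ ≤ 2 * ‖S Y‖ ^ 2 + 2 * T ^ 2 := by nlinarith [sq_nonneg (‖S Y‖ - T)]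
    _ ≤ 2 * ‖S Y‖ ^ 2 + 2 * V * ∑ b ∈ Ico 1 Y, ‖w (b + 1) - w b‖ * ‖S b‖ ^ 2 := by
        nlinarith [hCS, mul_le_mul_of_nonneg_right hV hW0]

/-- ALL ROWS: summing `row_sq_le` over the rows and swapping the sums, a bound `M` for the periodic
mean square `∑_a ‖S_a(u)‖²` uniform in the height `u ≤ Y` gives
`∑_a ‖∑_{b ≤ Y} w_b F_a(b)‖² ≤ 2 M (1 + V²)`. -/
private theorem sum_rows_sq_le (rows : Finset ℕ) (F S : ℕ → ℕ → ℂ)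
    (hS : ∀ a u, S a u = ∑ j ∈ Icc 1 u, F a j) (w : ℕ → ℂ) (hw1 : ∀ n, ‖w n‖ ≤ 1) (Y : ℕ)
    {V : ℝ} (hV : ∑ b ∈ Ico 1 Y, ‖w (b + 1) - w b‖ ≤ V)
    {M : ℝ} (hM : ∀ u ≤ Y, ∑ a ∈ rows, ‖S a u‖ ^ 2 ≤ M) :
    ∑ a ∈ rows, ‖∑ b ∈ Icc 1 Y, w b * F a b‖ ^ 2 ≤ 2 * M * (1 + V ^ 2) := by
  have hd0 : ∀ b, 0 ≤ ‖w (b + 1) - w b‖ := fun b => norm_nonneg _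
  have hV0 : 0 ≤ V := (sum_nonneg fun b _ => hd0 b).trans hV
  have h1 : ∑ a ∈ rows, ‖S a Y‖ ^ 2 ≤ M := hM Y le_rfl
  have h2 : ∑ b ∈ Ico 1 Y, ‖w (b + 1) - w b‖ * ∑ a ∈ rows, ‖S a b‖ ^ 2 ≤
      (∑ b ∈ Ico 1 Y, ‖w (b + 1) - w b‖) * M := by
    rw [sum_mul]
    exact sum_le_sum fun b hb => mul_le_mul_of_nonneg_left (hM b (mem_Ico.mp hb).2.le) (hd0 b)
  have hM0 : 0 ≤ M := (sum_nonneg fun a _ => by positivity).trans h1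
  have h3 : (∑ b ∈ Ico 1 Y, ‖w (b + 1) - w b‖) * M ≤ V * M :=
    mul_le_mul_of_nonneg_right hV hM0
  calc ∑ a ∈ rows, ‖∑ b ∈ Icc 1 Y, w b * F a b‖ ^ 2
      ≤ ∑ a ∈ rows, (2 * ‖S a Y‖ ^ 2 +
          2 * V * ∑ b ∈ Ico 1 Y, ‖w (b + 1) - w b‖ * ‖S a b‖ ^ 2) :=
        sum_le_sum fun a _ => row_sq_le (F a) w (S a) (hS a) hw1 Y hV
    _ = 2 * ∑ a ∈ rows, ‖S a Y‖ ^ 2 +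
          2 * V * ∑ b ∈ Ico 1 Y, ‖w (b + 1) - w b‖ * ∑ a ∈ rows, ‖S a b‖ ^ 2 := by
        simp only [mul_sum, sum_add_distrib]
        rw [sum_comm]
    _ ≤ 2 * M * (1 + V ^ 2) := by
        nlinarith [mul_le_mul_of_nonneg_left (h2.trans h3) hV0]

/-- The final real-variable inequality: `2 · P/L^{C+2K+2} · (1 + L^{2K}) ≤ P/L^C` once `L ≥ 2`. -/
private theorem final_real {P L C K : ℝ} (hP : 0 ≤ P) (hL : 2 ≤ L) (hK : 0 ≤ K) :
    2 * (P / L ^ (C + (K + K) + 2)) * (1 + (L ^ K) ^ 2) ≤ P / L ^ C := by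
  have hL0 : 0 < L := by linarith
  have hQ1 : 1 ≤ L ^ K := Real.one_le_rpow (by linarith) hK
  have hQ2 : 1 ≤ (L ^ K) ^ 2 := one_le_pow₀ hQ1
  have hL4 : 4 ≤ L ^ 2 := by nlinarith
  have hkey : 2 * (1 + (L ^ K) ^ 2) ≤ L ^ K * L ^ K * L ^ 2 := by
    nlinarith [mul_le_mul_of_nonneg_left hL4 (sq_nonneg (L ^ K))]
  have hsplit : L ^ (C + (K + K) + 2) = L ^ C * (L ^ K * L ^ K) * L ^ 2 := by
    rw [Real.rpow_add hL0, Real.rpow_add hL0, Real.rpow_add hL0, Real.rpow_two]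
  have hLC : 0 < L ^ C := Real.rpow_pos_of_pos hL0 C
  have hLK : 0 < L ^ K := Real.rpow_pos_of_pos hL0 K
  rw [hsplit]
  calc 2 * (P / (L ^ C * (L ^ K * L ^ K) * L ^ 2)) * (1 + (L ^ K) ^ 2)
      = P / (L ^ C * (L ^ K * L ^ K) * L ^ 2) * (2 * (1 + (L ^ K) ^ 2)) := by ring
    _ ≤ P / (L ^ C * (L ^ K * L ^ K) * L ^ 2) * (L ^ K * L ^ K * L ^ 2) :=
        mul_le_mul_of_nonneg_left hkey (by positivity)
    _ = P / L ^ C := by field_simp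

/-- **STUB `stub_archTwist_periodicCols`** (r4 calibration T3 of line `helson-kronecker-inverse`,
crux stmt-Parity-14270): THE RESIDUAL ON ARCHIMEDEAN TWISTS OF PERIODIC WEIGHTS. For column weights
`g` that agree on `[1, ⌊x/A⌋]` with `h·w`, `h` `q`-periodic and 1-bounded (`1 ≤ q ≤ (log x)^K`), `w`
1-bounded with total variation `∑_{b ≤ ⌊x/A⌋} ‖w(b+1) − w(b)‖ ≤ (log x)^K` on the columns (e.g.
`w(b) = b^{it}`, so `g = χ(n) n^{it}`), the mean square over the rows `a ∈ (⌊A⌋,⌊2A⌋]` of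
`∑_{b ≤ ⌊y⌋} g(b) λ(ab+c)` is `≤ x(x/A)/(log x)^C` for `x ≥ x₀(c,δ,C,K)`, uniformly in
`x^δ ≤ A ≤ x^{1/3+δ}` and `y ≤ x/A`: Abel summation in `b` against `w` and weighted Cauchy–Schwarz
(`sum_rows_sq_le`) reduce it to the CM-free periodic bound `meanSquare_periodicCols_nat` (from the
landed `stub_bv`) at exponent `C + 2K + 2`, uniformly in the height `u ≤ ⌊y⌋`. -/
theorem stub_archTwist_periodicCols :
    ∀ c : ℤ, c ≠ 0 → ∀ δ : ℝ, 0 < δ → δ ≤ 1 / 12 → ∀ C : ℝ, 0 < C → ∀ K : ℝ, 0 < K → ∃ x₀ : ℝ,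
    ∀ x : ℝ, x₀ ≤ x → ∀ A : ℝ, x ^ δ ≤ A → A ≤ x ^ (1 / 3 + δ) →
    ∀ g : ℕ → ℂ,
    (∃ q : ℕ, 1 ≤ q ∧ (q : ℝ) ≤ Real.log x ^ K ∧ ∃ h : ℕ → ℂ, Function.Periodic h q ∧
      (∀ n : ℕ, ‖h n‖ ≤ 1) ∧ ∃ w : ℕ → ℂ, (∀ n : ℕ, ‖w n‖ ≤ 1) ∧
        (∑ b ∈ Finset.Icc 1 ⌊x / A⌋₊, ‖w (b + 1) - w b‖ ≤ Real.log x ^ K) ∧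
        ∀ b ∈ Finset.Icc 1 ⌊x / A⌋₊, g b = h b * w b) →
    ∀ y : ℝ, y ≤ x / A →
      ∑ a ∈ Finset.Ioc ⌊A⌋₊ ⌊2 * A⌋₊,
          ‖∑ b ∈ Finset.Icc 1 ⌊y⌋₊, g b *
            ((ArithmeticFunction.liouville (Int.toNat ((a : ℤ) * b + c)) : ℝ) : ℂ)‖ ^ 2 ≤
        x * (x / A) / Real.log x ^ C := by
  intro c _ δ hδ hδ12 C hC K hK
  -- the CM-free periodic bound at exponent `C + 2K + 2`, and `log x ≥ 2`
  obtain ⟨x₁, hx₁⟩ := meanSquare_periodicCols_nat stub_bv c hδ hδ12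
    (show (0 : ℝ) < C + (K + K) + 2 by linarith) hK
  obtain ⟨X, hX⟩ := Negative.eventually_rpow_log_ge hK 1
  refine ⟨max x₁ (max X 1), ?_⟩
  intro x hx A hA hA' g hg y hy
  obtain ⟨q, hq, hqK, h, hper, hh1, w, hw1, hvar, hgcols⟩ := hg
  simp only [max_le_iff] at hx
  obtain ⟨hxx₁, hxX, hx1⟩ := hx
  obtain ⟨-, hL2⟩ := hX x hxX
  have hMS := hx₁ x hxx₁ A hA hA' h q hq hqK hper hh1
  set L := Real.log x
  have hA0 : 0 < A := one_pos.trans_le ((Real.one_le_rpow hx1 hδ.le).trans hA)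
  have hx0 : 0 ≤ x := by linarith
  set B := ⌊x / A⌋₊
  set Y := ⌊y⌋₊ with hY_def
  have hYB : Y ≤ B := by
    rcases le_or_gt 0 y with hy0 | hy0
    · exact Nat.floor_mono hy
    · rw [hY_def, Nat.floor_of_nonpos hy0.le]; exact Nat.zero_le _
  -- on the columns `g = w · h`
  have hrew : ∀ a : ℕ,
      ∑ b ∈ Icc 1 Y, g b * ((liouville (Int.toNat ((a : ℤ) * b + c)) : ℝ) : ℂ) =
        ∑ b ∈ Icc 1 Y, w b * (h b * ((liouville (Int.toNat ((a : ℤ) * b + c)) : ℝ) : ℂ)) := by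
    intro a
    refine sum_congr rfl fun b hb => ?_
    rw [hgcols b (Icc_subset_Icc_right hYB hb)]; ring
  -- the partial sums of the periodic weight, bounded at every height `u ≤ Y ≤ B`
  obtain ⟨S, hS⟩ : ∃ S : ℕ → ℕ → ℂ, ∀ a u, S a u =
      ∑ j ∈ Icc 1 u, h j * ((liouville (Int.toNat ((a : ℤ) * j + c)) : ℝ) : ℂ) :=
    ⟨_, fun _ _ => rfl⟩
  have hM : ∀ u ≤ Y, ∑ a ∈ Ioc ⌊A⌋₊ ⌊2 * A⌋₊, ‖S a u‖ ^ 2 ≤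
      x * (x / A) / L ^ (C + (K + K) + 2) := fun u hu => by
    simp only [hS]; exact hMS u (hu.trans hYB)
  -- the total variation of `w` on `[1, Y) ⊆ [1, B]`
  have hV : ∑ b ∈ Ico 1 Y, ‖w (b + 1) - w b‖ ≤ L ^ K := by
    refine le_trans (sum_le_sum_of_subset_of_nonneg (fun b hb => ?_)
      (fun _ _ _ => norm_nonneg _)) hvar
    rw [mem_Icc]; rw [mem_Ico] at hb; omega
  calc ∑ a ∈ Ioc ⌊A⌋₊ ⌊2 * A⌋₊,
        ‖∑ b ∈ Icc 1 Y, g b * ((liouville (Int.toNat ((a : ℤ) * b + c)) : ℝ) : ℂ)‖ ^ 2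
      = ∑ a ∈ Ioc ⌊A⌋₊ ⌊2 * A⌋₊, ‖∑ b ∈ Icc 1 Y,
          w b * (h b * ((liouville (Int.toNat ((a : ℤ) * b + c)) : ℝ) : ℂ))‖ ^ 2 :=
        sum_congr rfl fun a _ => by rw [hrew a]
    _ ≤ 2 * (x * (x / A) / L ^ (C + (K + K) + 2)) * (1 + (L ^ K) ^ 2) :=
        sum_rows_sq_le (Ioc ⌊A⌋₊ ⌊2 * A⌋₊)
          (fun a b => h b * ((liouville (Int.toNat ((a : ℤ) * b + c)) : ℝ) : ℂ)) S hS w hw1 Y hV hM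
    _ ≤ x * (x / A) / L ^ C := final_real (by positivity) hL2 hK.le

end

end Summit.Parity.GeneralizedHardyLittlewood.Theorems.TableChowla.HelsonKroneckerInverse
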